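import Summits.QuantumFields.YangMills.Theorems.SpecificationCompactnessCondExpDensityCalculus
import Summits.QuantumFields.YangMills.Theorems.SpecificationCompactnessCondExpDensityUI
import HarnessLib

/-!
# Scheffé without fibres for an UNBOUNDED fibre-normalised profile — route-independent kernel of `DensityMergingAE`
# (route `SpecificationCompactness`, LINE 14 «tail_trivial_kernel», support S1°, stmt-QuantumFields-22689)

For every torus family `F`, `γ > 0` and single-link profiles `q_e` (measurable, `≥ 0`, fibre-normalised
`π₀[q_e | links ≠ e] = 1` a.e.): if the canonical single-link conditional densities converge IN π₀-MEASURE,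
`ρ̂_K/π₀[ρ̂_K | links ≠ e] → q_e`, and the normalised densities `ũ_K = ρ̂_K/∫ρ̂_K` are uniformly integrable, then
`∫ |ũ_K − π₀[ũ_K | links ≠ e]·q_e| dπ₀ → 0` for every link `e`.

THE ARGUMENT (Scheffé without fibres and WITHOUT A BOUND ON `q`; the tree's
`tendsto_integral_abs_sub_condExp_mul[_of_tendstoInMeasure]` needs `q ≤ Q`).  With `c_K = π[u_K|m]`:
(1) `π[q|m] = 1` a.e. forces `q ∈ L¹` and makes `q·π` and `π` AGREE ON `m` (`(q·π).trim m = π.trim m`), so for the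
`m`-measurable integrable `c_K` one gets `c_K·q ∈ L¹(π)` and `∫ c_K q dπ = ∫ c_K dπ = ∫ u_K dπ` — no pull-out with an
unbounded factor is needed; (2) hence `∫|u_K − c_K q| = 2∫(u_K − c_K q)₊`; (3) a.e. `(u_K − c_K q)₊ ≤ δ·c_K` on
`{dist(u_K/c_K, q) < δ}` (where `c_K = 0`, `u_K = 0` a.e.) and `≤ u_K` on the complement `B_K`, whose mass tends to `0`
(in-measure convergence); `∫_{B_K} u_K ≤ M·π(B_K) + ∫(u_K − M)₊` (uniform integrability) closes the estimate.
The item itself (instantiation on `X₀ = SU(2)^{unit bonds}`) is closed in `SpecificationCompactnessDensityMergingAE.lean`; this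
file imports no route file (Mathlib + the two route-independent `CondExpDensity*` helpers only).

HONEST FRAMING.  Measure theory only (rung R3 RECORD line): the cruxes `SpecificationLimitAE` / `UnitDensityUI` are
hypotheses, nothing is proved about them, about `ContinuumYM3Torus`, or about the YM mass gap.  No definitions, no named
facts. [folklore] (Scheffé/Vitali; [cite: Georgii2011, Thm 4.17] for the DLR pattern.)
-/

noncomputable section

namespace Summit.QuantumFields.YangMills.Theorems.SpecificationCompactnessDensityMerging

open MeasureTheory Filter Topology
open scoped ENNReal
open Summit.QuantumFields.YangMills.Theorems.SpecificationCompactnessKernel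

variable {X : Type*} {m m0 : MeasurableSpace X} {π : Measure X}

/-! ## §1 A fibre-normalised profile: `q·π` and `π` agree on `m` -/

/-- `π[q|m] = 1` a.e. forces `q ∈ L¹(π)` (Mathlib's `condExp` of a non-integrable function is `0`). [folklore] -/
theorem integrable_of_condExp_ae_eq_one [IsProbabilityMeasure π] {q : X → ℝ}
    (hq1 : ∀ᵐ x ∂π, π[q|m] x = 1) : Integrable q π := by
  by_contra h
  have h0 : π[q|m] = 0 := condExp_of_not_integrable h
  have h2 : ∀ᵐ x ∂π, (0 : ℝ) = 1 := hq1.mono fun x hx => by rw [← hx, h0]; rfl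
  obtain ⟨x, hx⟩ := h2.exists
  exact zero_ne_one hx

/-- The trimmed measures agree: `(q·π).trim m = π.trim m` when `π[q|m] = 1` a.e. (`q ≥ 0` measurable). [folklore] -/
theorem trim_withDensity_eq [IsFiniteMeasure π] (hm : m ≤ m0) {q : X → ℝ}
    (hq0 : ∀ x, 0 ≤ q x) (hq1 : ∀ᵐ x ∂π, π[q|m] x = 1) (hqi : Integrable q π) :
    (π.withDensity fun x => ENNReal.ofReal (q x)).trim hm = π.trim hm := by
  refine @Measure.ext _ m _ _ (fun s hs => ?_)
  rw [trim_measurableSet_eq hm hs, trim_measurableSet_eq hm hs, withDensity_apply _ (hm s hs)]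
  have h1 : ∫⁻ x in s, ENNReal.ofReal (q x) ∂π = ENNReal.ofReal (∫ x in s, q x ∂π) :=
    (ofReal_integral_eq_lintegral_ofReal hqi.integrableOn (Eventually.of_forall fun x => hq0 x)).symm
  have h2 : ∫ x in s, q x ∂π = ∫ x in s, (π[q|m]) x ∂π := (setIntegral_condExp hm hqi hs).symm
  have h3 : ∫ x in s, (π[q|m]) x ∂π = ∫ x in s, (1 : ℝ) ∂π :=
    setIntegral_congr_ae (hm s hs) (hq1.mono fun x hx _ => hx)
  rw [h1, h2, h3, setIntegral_const, smul_eq_mul, mul_one, measureReal_def,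
    ENNReal.ofReal_toReal (measure_ne_top π s)]

/-- Integrability of `π[u|m]·q` and `∫ π[u|m]·q dπ = ∫ u dπ` for a fibre-normalised measurable `q ≥ 0` — NO boundedness of
`q` or of `π[u|m]` is needed (and no integrability of `u`: Mathlib's conventions make both sides `0` otherwise). [folklore] -/
theorem integrable_condExp_mul_and_integral_eq [IsFiniteMeasure π] (hm : m ≤ m0) {u q : X → ℝ}
    (hq : Measurable q) (hq0 : ∀ x, 0 ≤ q x) (hq1 : ∀ᵐ x ∂π, π[q|m] x = 1) (hqi : Integrable q π) :
    Integrable (fun x => π[u|m] x * q x) π ∧ ∫ x, π[u|m] x * q x ∂π = ∫ x, u x ∂π := by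
  have hcm : StronglyMeasurable[m] (π[u|m]) := stronglyMeasurable_condExp
  have hci : Integrable (π[u|m]) π := integrable_condExp
  have htrim := trim_withDensity_eq hm hq0 hq1 hqi
  have hν_int : Integrable (π[u|m]) (π.withDensity fun x => ENNReal.ofReal (q x)) := by
    refine integrable_of_integrable_trim hm ?_
    rw [htrim]
    exact hci.trim hm hcm
  have hiff := integrable_withDensity_iff_integrable_smul' (μ := π) (f := fun x => ENNReal.ofReal (q x))
    (g := π[u|m]) hq.ennreal_ofReal (Eventually.of_forall fun _ => ENNReal.ofReal_lt_top)
  have h1 : Integrable (fun x => π[u|m] x * q x) π := by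
    refine (hiff.mp hν_int).congr (Eventually.of_forall fun x => ?_)
    show (ENNReal.ofReal (q x)).toReal • π[u|m] x = π[u|m] x * q x
    rw [ENNReal.toReal_ofReal (hq0 x), smul_eq_mul, mul_comm]
  refine ⟨h1, ?_⟩
  calc ∫ x, π[u|m] x * q x ∂π = ∫ x, q x * π[u|m] x ∂π := by
        refine integral_congr_ae (Eventually.of_forall fun x => ?_); show π[u|m] x * q x = q x * π[u|m] x; ring
    _ = ∫ x, π[u|m] x ∂(π.withDensity fun x => ENNReal.ofReal (q x)) := (integral_lawOf hq hq0 _).symm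
    _ = ∫ x, π[u|m] x ∂((π.withDensity fun x => ENNReal.ofReal (q x)).trim hm) := integral_trim hm hcm
    _ = ∫ x, π[u|m] x ∂(π.trim hm) := by rw [htrim]
    _ = ∫ x, π[u|m] x ∂π := (integral_trim hm hcm).symm
    _ = ∫ x, u x ∂π := integral_condExp hm

/-! ## §2 Scheffé without fibres, for an unbounded profile -/

/-- **SCHEFFÉ–VITALI WITHOUT FIBRES, UNBOUNDED PROFILE, IN-MEASURE VERSION.**  `π` a probability law, `m ≤ m0`;
measurable integrable densities `u_K ≥ 0`; a measurable profile `q ≥ 0` with `π[q|m] = 1` a.e. (no bound); the ratios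
`u_K/π[u_K|m] → q` IN π-MEASURE; the `u_K` uniformly integrable (`∫ (u_K − M)₊ ≤ ε` for `K ≥ K₀`).
Then `∫ |u_K − π[u_K|m]·q| dπ → 0`. [folklore] -/
theorem tendsto_integral_abs_sub_condExp_mul_unbounded (hm : m ≤ m0) [IsProbabilityMeasure π]
    {u : ℕ → X → ℝ} (hu : ∀ K, Measurable (u K)) (hu0 : ∀ K x, 0 ≤ u K x) (hui : ∀ K, Integrable (u K) π)
    {q : X → ℝ} (hq : Measurable q) (hq0 : ∀ x, 0 ≤ q x) (hq1 : ∀ᵐ x ∂π, π[q|m] x = 1)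
    (hlim : TendstoInMeasure π (fun K x => u K x / π[u K|m] x) atTop q)
    (hUI : ∀ ε : ℝ, 0 < ε → ∃ (M : ℝ) (K₀ : ℕ), ∀ K, K₀ ≤ K → ∫ x, max (u K x - M) 0 ∂π ≤ ε) :
    Tendsto (fun K => ∫ x, |u K x - π[u K|m] x * q x| ∂π) atTop (𝓝 0) := by
  have hqi : Integrable q π := integrable_of_condExp_ae_eq_one hq1
  have hcm : ∀ K, StronglyMeasurable[m] (π[u K|m]) := fun K => stronglyMeasurable_condExp
  have hcm0 : ∀ K, Measurable (π[u K|m]) := fun K => ((hcm K).mono hm).measurable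
  have hci : ∀ K, Integrable (π[u K|m]) π := fun K => integrable_condExp
  have hc0 : ∀ K, ∀ᵐ x ∂π, 0 ≤ π[u K|m] x := fun K => condExp_nonneg (Eventually.of_forall (hu0 K))
  have hcz : ∀ K, ∀ᵐ x ∂π, π[u K|m] x = 0 → u K x = 0 := fun K =>
    ae_eq_zero_of_condExp_eq_zero hm (hu0 K) (hui K)
  have hcq : ∀ K, Integrable (fun x => π[u K|m] x * q x) π ∧ ∫ x, π[u K|m] x * q x ∂π = ∫ x, u K x ∂π :=
    fun K => integrable_condExp_mul_and_integral_eq hm hq hq0 hq1 hqi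
  -- (2) the L¹ distance is twice the positive part `(u_K − c_K q)₊`
  have hL1 : ∀ K, ∫ x, |u K x - π[u K|m] x * q x| ∂π = 2 * ∫ x, max (u K x - π[u K|m] x * q x) 0 ∂π := by
    intro K
    have hdiff : Integrable (fun x => π[u K|m] x * q x - u K x) π := (hcq K).1.sub (hui K)
    have hpos : Integrable (fun x => max (u K x - π[u K|m] x * q x) 0) π := ((hui K).sub (hcq K).1).pos_part
    have h1 : ∫ x, |u K x - π[u K|m] x * q x| ∂π
        = ∫ x, (π[u K|m] x * q x - u K x) + 2 * max (u K x - π[u K|m] x * q x) 0 ∂π := by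
      refine integral_congr_ae (Eventually.of_forall fun x => ?_)
      show |u K x - π[u K|m] x * q x| = (π[u K|m] x * q x - u K x) + 2 * max (u K x - π[u K|m] x * q x) 0
      rw [abs_sub_comm]; exact abs_sub_eq_sub_add_two_mul_max _ _
    rw [h1, integral_add hdiff (hpos.const_mul 2), integral_sub (hcq K).1 (hui K), (hcq K).2, sub_self,
      zero_add, integral_const_mul]
  -- (3) ε-assembly
  rw [Metric.tendsto_atTop]
  intro η hη
  -- a mass bound from uniform integrability
  obtain ⟨M₁, K₁, hM₁⟩ := hUI 1 one_pos
  set A : ℝ := max M₁ 0 + 1 with hA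
  have hA0 : 0 < A := by positivity
  have hmass : ∀ K, K₁ ≤ K → ∫ x, u K x ∂π ≤ A := by
    intro K hK
    have hle : ∀ x, u K x ≤ max M₁ 0 + max (u K x - M₁) 0 := fun x => by
      rcases le_total (u K x) M₁ with h | h
      · linarith [le_max_left M₁ 0, le_max_right (u K x - M₁) 0]
      · linarith [le_max_left M₁ 0, le_max_left (u K x - M₁) 0]
    have hpi : Integrable (fun x => max (u K x - M₁) 0) π := ((hui K).sub (integrable_const M₁)).pos_part
    calc ∫ x, u K x ∂π ≤ ∫ x, (max M₁ 0 + max (u K x - M₁) 0) ∂π :=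
          integral_mono (hui K) ((integrable_const _).add hpi) hle
      _ = max M₁ 0 + ∫ x, max (u K x - M₁) 0 ∂π := by
          rw [integral_add (integrable_const _) hpi, integral_const, smul_eq_mul, probReal_univ, one_mul]
      _ ≤ A := by rw [hA]; linarith [hM₁ K hK]
  -- the UI level for `η/8`, WLOG non-negative
  obtain ⟨M, K₂, hM⟩ := hUI (η / 8) (by positivity)
  set M' : ℝ := max M 0 with hM'
  have hM'0 : 0 ≤ M' := le_max_right _ _
  have hM'le : ∀ K, K₂ ≤ K → ∫ x, max (u K x - M') 0 ∂π ≤ η / 8 := fun K hK => by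
    refine le_trans (integral_mono_of_nonneg (Eventually.of_forall fun x => le_max_right _ _)
      (((hui K).sub (integrable_const M)).pos_part) (Eventually.of_forall fun x => ?_)) (hM K hK)
    exact max_le_max (sub_le_sub_left (le_max_left M 0) _) le_rfl
  -- the in-measure level
  set δ : ℝ := η / (8 * A) with hδ
  have hδ0 : 0 < δ := by positivity
  have hθ : (0 : ℝ) < η / (8 * (M' + 1)) := by positivity
  obtain ⟨K₃, hK₃⟩ := Filter.eventually_atTop.mp
    ((tendstoInMeasure_iff_measureReal_dist.mp hlim δ hδ0).eventually (gt_mem_nhds hθ))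
  refine ⟨max K₁ (max K₂ K₃), fun K hK => ?_⟩
  have hK1 : K₁ ≤ K := le_of_max_le_left hK
  have hK2 : K₂ ≤ K := le_of_max_le_left (le_of_max_le_right hK)
  have hK3 : K₃ ≤ K := le_of_max_le_right (le_of_max_le_right hK)
  -- the bad set
  set B : Set X := {x | δ ≤ dist (u K x / π[u K|m] x) (q x)} with hBdef
  have hBm : MeasurableSet B := measurableSet_le measurable_const (((hu K).div (hcm0 K)).dist hq)
  have hBreal : π.real B < η / (8 * (M' + 1)) := hK₃ K hK3
  -- pointwise a.e. bound on the positive part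
  have hptw : ∀ᵐ x ∂π, max (u K x - π[u K|m] x * q x) 0 ≤ δ * π[u K|m] x + B.indicator (u K) x := by
    filter_upwards [hc0 K, hcz K] with x hx0 hxz
    by_cases hxB : x ∈ B
    · rw [Set.indicator_of_mem hxB]
      have h1 : max (u K x - π[u K|m] x * q x) 0 ≤ u K x :=
        max_le (sub_le_self _ (mul_nonneg hx0 (hq0 x))) (hu0 K x)
      nlinarith [mul_nonneg hδ0.le hx0]
    · rw [Set.indicator_of_notMem hxB, add_zero]
      have hlt : dist (u K x / π[u K|m] x) (q x) < δ := not_le.mp hxB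
      rcases hx0.eq_or_lt with h0 | hpos
      · rw [hxz h0.symm, ← h0]; simp
      · refine max_le ?_ (mul_nonneg hδ0.le hx0)
        rw [Real.dist_eq] at hlt
        have h2 : u K x / π[u K|m] x - q x < δ := (abs_lt.mp hlt).2
        have hu_eq : u K x = π[u K|m] x * (u K x / π[u K|m] x) := by
          field_simp
        calc u K x - π[u K|m] x * q x = π[u K|m] x * (u K x / π[u K|m] x - q x) := by
              rw [mul_sub, ← hu_eq]
          _ ≤ π[u K|m] x * δ := mul_le_mul_of_nonneg_left h2.le hx0
          _ = δ * π[u K|m] x := mul_comm _ _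
  -- integrate the pointwise bound
  have hψi : Integrable (fun x => max (u K x - π[u K|m] x * q x) 0) π := ((hui K).sub (hcq K).1).pos_part
  have hInt : ∫ x, max (u K x - π[u K|m] x * q x) 0 ∂π ≤ δ * ∫ x, u K x ∂π + ∫ x in B, u K x ∂π := by
    calc ∫ x, max (u K x - π[u K|m] x * q x) 0 ∂π ≤ ∫ x, δ * π[u K|m] x + B.indicator (u K) x ∂π :=
          integral_mono_ae hψi (((hci K).const_mul δ).add ((hui K).indicator hBm)) hptw
      _ = δ * ∫ x, π[u K|m] x ∂π + ∫ x in B, u K x ∂π := by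
          rw [integral_add ((hci K).const_mul δ) ((hui K).indicator hBm), integral_const_mul,
            integral_indicator hBm]
      _ = δ * ∫ x, u K x ∂π + ∫ x in B, u K x ∂π := by rw [integral_condExp hm]
  -- uniform integrability on the bad set
  have hBint : ∫ x in B, u K x ∂π ≤ M' * π.real B + ∫ x, max (u K x - M') 0 ∂π := by
    have hpi : Integrable (fun x => max (u K x - M') 0) π := ((hui K).sub (integrable_const M')).pos_part
    have hle : ∀ x, u K x ≤ M' + max (u K x - M') 0 := fun x => by linarith [le_max_left (u K x - M') 0]
    calc ∫ x in B, u K x ∂π ≤ ∫ x in B, (M' + max (u K x - M') 0) ∂π :=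
          setIntegral_mono (hui K).integrableOn ((integrable_const _).add hpi).integrableOn hle
      _ = M' * π.real B + ∫ x in B, max (u K x - M') 0 ∂π := by
          rw [integral_add (integrable_const _).integrableOn hpi.integrableOn, setIntegral_const, smul_eq_mul,
            mul_comm]
      _ ≤ M' * π.real B + ∫ x, max (u K x - M') 0 ∂π := by
          have := setIntegral_le_integral (s := B) hpi (Eventually.of_forall fun x => le_max_right _ _)
          linarith
  -- assemble
  rw [dist_zero_right, Real.norm_eq_abs, abs_of_nonneg (integral_nonneg fun x => abs_nonneg _), hL1 K]
  have h1 : δ * ∫ x, u K x ∂π ≤ η / 8 := by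
    calc δ * ∫ x, u K x ∂π ≤ δ * A :=
          mul_le_mul_of_nonneg_left (hmass K hK1) hδ0.le
      _ = η / 8 := by rw [hδ]; field_simp
  have h2 : M' * π.real B ≤ η / 8 := by
    have hfrac : M' / (M' + 1) ≤ 1 := (div_le_one (by positivity)).mpr (by linarith)
    calc M' * π.real B ≤ M' * (η / (8 * (M' + 1))) := mul_le_mul_of_nonneg_left hBreal.le hM'0
      _ = (η / 8) * (M' / (M' + 1)) := by field_simp
      _ ≤ η / 8 := mul_le_of_le_one_right (by positivity) hfrac
  have h3 := hM'le K hK2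
  linarith [hInt, hBint]

end Summit.QuantumFields.YangMills.Theorems.SpecificationCompactnessDensityMerging

end
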